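import Literature.NumberTheory.DiophantineGeometry.TateAlgorithmIstarEvalProofs
import Literature.NumberTheory.DiophantineGeometry.TateAlgorithmEvalProofs
import Literature.NumberTheory.DiophantineGeometry.LocalReductionHasMultiplicativeReductionAtProofs
import Literature.NumberTheory.DiophantineGeometry.LocalReductionMinimalityProofs
import Literature.NumberTheory.DiophantineGeometry.LocalReductionFiniteBadPlacesProofs
import Literature.NumberTheory.DiophantineGeometry.EllArithGlue
import Literature.NumberTheory.EllipticCurves.QuadraticTwistTateFormTwoProofs
import Literature.NumberTheory.EllipticCurves.QuadraticTwistKroneckerLFunctionProofs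
import Literature.NumberTheory.EllipticCurves.QuadraticTwistProofs
import Literature.NumberTheory.EllipticCurves.SzpiroLocalDataProofs
import Literature.NumberTheory.EllipticCurves.TamagawaSubgroupProofs
import Literature.NumberTheory.EllipticCurves.GlobalMinimalModel
import Literature.RingTheory.DiscreteValuationRing.AdicCompletionResidueField
import HarnessLib

/-!
# The ramified quadratic twist of a `p`-semistable curve has Kodaira type `I₀*` / `Iₙ*` at the odd prime `p` (cell `b2b-bsdres`, seat additive-p4, line V9d)

HONEST FRAMING (cell `b2b-bsdres`, run/shared/lean/b2b/bsd-rank1-residual/, verbatim in every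
file): the goal of the cell is to DELETE the COMBINATION-SHAPED residual classes of the
Birch–Swinnerton-Dyer formula for ALL analytic-rank `≤ 1` elliptic curves over `ℚ` — "full BSD
formula for every rank `≤ 1` curve in class `C`" assembled STRICTLY from published theorems — so
that the rank-`≤ 1` remainder becomes exactly the CONSTRUCTION-SHAPED classes, which are TYPED
(missing-input `Prop`s), NOT attempted. This is not "finishing BSD". The additive sub-cell (seats
additive-p1…p4) is a RESEARCH ROUTE on the construction-shaped classes X3/X4; no claim beyond the
stated classes; the labels of X3/X4 are UNCHANGED.

Theorems only (no definition, no named fact); ELEMENTARY local arithmetic of Weierstrass equations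
assembled from the tree's Tate algorithm (`TateAlgorithm*`, Silverman *ATAEC* IV.9.4) and its
evaluation API (`TateAlgorithmEvalProofs`, `TateAlgorithmIstarEvalProofs`). This is item V9d of
the seat's repair census (HOME/b2b-bsdres-additive-p4/REPAIR-CENSUS.md): it DISCHARGES the per-pair
hypothesis `p ∤ c_p(E)` of the odd V9/V9b assemblies (`X3RankZeroTwistOdd.missingUpperBoundAt`,
`X4RankZeroTwistOdd.missingUpperBoundAt`, `X3RankZeroTwist.missingUpperBoundAt_of_odd_prime`), which
is only binding at `p = 3` (for `p ≥ 5`, `c_p ≤ 4 < p` at an additive prime).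

* `kodairaSymbolOfMinimal_twist_semistable_eq_Istar` — over any discrete valuation ring `R` with
  perfect residue field and `2 ∈ Rˣ`: for `β₂, β₄, β₆ ∈ R` with `y² = x³ + β₂x² + β₄x + β₆`
  semistable (`Δ ∈ Rˣ` or `c₄ ∈ Rˣ`) and `w ∈ Rˣ`, Tate's algorithm on the twisted equation
  `y² = x³ + ϖwβ₂x² + ϖ²w²β₄x + ϖ³w³β₆` returns `Iₙ*` (`n = 0` in the good case — three distinct
  roots of the step-6 cubic `w̄³P(T/w̄)`, `P` the 2-division cubic —, `n ≥ 1` in the multiplicative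
  case — a double, not triple, root, since `c₄ = 16(β₂² − 3β₄)` is a unit).
* `kodairaSymbolAt_twist_of_semistable` — for `V/ℚ` globally minimal, good or multiplicative at the
  place `v` over an odd prime `ℓ`, `D ∈ ℤ` with `ℓ ∥ D`, and ANY equation `W = C • V^{(D)}`:
  `W.kodairaSymbolAt v = Iₙ*` (the twisted equation is `v`-integral and `v`-minimal, Silverman *AEC*
  VII.1 Rem. 1.1, and over `O_v` it is the twist by the uniformiser `D = ϖw` of the short equation
  `y² = x³ + (b₂/4)x² + (b₄/2)x + b₆/4` of `V`, which has the same `Δ` and `c₄` as `V`).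

Consumer: `Additive/RamifiedTwistTamagawa.lean` (`c_v(W) ∈ {1, 2, 4}`, `p ∤ c_p(W)` for `W ≅ V^{(±p)}`).
The companion `X2/TwistKodaira.lean` (eisenstein-p2) proves the good case at `ℓ ≥ 5` through Ogg's
formula in the tame case; the present file runs Tate's algorithm directly, so it covers `ℓ = 3` and
the multiplicative case (`Iₙ*`, `n ≥ 1`), which is what the X3/X4 (M)-cells at `p = 3` need.
Census check (harvest-2, HOME/b2b-bsdres-harvest-2/census/v9_r6/R6_answer.md (2)): on the 454
rank-0 V9 rows `c_p(E) ∈ {1, 2, 4}` on 454/454 (`I₀*`: 175, `Iₙ*`: 279), as the theorem predicts.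

References: [SilvermanATAEC1994] IV.9.4 (Tate's algorithm, Steps 6–7; Rem. IV.9.3; Table 4.1);
[SilvermanAEC2009] VII.1 Rem. 1.1, Prop. 1.3, VII.5 Prop. 5.1, VII.6 Thm. 6.1; S. Comalada,
*Twists and reduction of an elliptic curve*, J. Number Theory 49 (1994) §2.
-/

noncomputable section

open scoped Classical

open Polynomial IsLocalRing
open Literature.NumberTheory.DiophantineGeometry Literature.NumberTheory.DiophantineGeometry.TateAlgorithm

namespace Summit.BirchSwinnertonDyer.Rank1Residual.Additive

section DVR

variable {R : Type*} [CommRing R] [IsDomain R] [IsDiscreteValuationRing R]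

/-- **Tate's algorithm on the twist of a semistable short equation by a uniformiser.** Let `R` be a
discrete valuation ring with perfect residue field in which `2` is a unit, `ϖ` its chosen
uniformiser, `w ∈ Rˣ`, and `V₀ : y² = x³ + β₂x² + β₄x + β₆` an integral equation which is
*semistable* (`Δ(V₀) ∈ Rˣ` or `c₄(V₀) ∈ Rˣ`). Then on the twisted equation
`J : y² = x³ + ϖwβ₂·x² + ϖ²w²β₄·x + ϖ³w³β₆` (the quadratic twist of `V₀` by `d = ϖw`) Tate's
algorithm returns a type `Iₙ*` (`n ≥ 0`): `J` is step-6 normalised and its step-6 cubic is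
`T³ + w̄β̄₂T² + w̄²β̄₄T + w̄³β̄₆ = w̄³·P(T/w̄)`, `P` the reduction of the 2-division cubic of `V₀`;
`Δ(V₀) = 16·disc P` and `c₄(V₀) = 16·(β₂² − 3β₄)`, so `P` has three distinct roots if `Δ(V₀)`
is a unit (Step 6: `I₀*`) and exactly two if `Δ(V₀) ∈ 𝔪`, `c₄(V₀) ∈ Rˣ` (Step 7: `Iₙ*`, `n ≥ 1`,
read on the translated model of `exists_variableChange_step7_of_dvd` through the evaluation API
`kodairaSymbolOfMinimal_eq_Istar_of_models`). Silverman *ATAEC* IV.9.4 Steps 6–7; the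
classical statement "a ramified quadratic twist of a curve with good (resp. multiplicative)
reduction at `p` odd has type `I₀*` (resp. `Iₙ*`)" (Comalada, J. Number Theory 49 (1994) §2).
[cite: SilvermanATAEC1994, IV.9.4 Steps 6–7 (PDF pp. 345–346)] -/
theorem kodairaSymbolOfMinimal_twist_semistable_eq_Istar [PerfectField (ResidueField R)]
    (h2 : IsUnit (2 : R)) {J : WeierstrassCurve R} {w β₂ β₄ β₆ : R} (hw : IsUnit w)
    (h1 : J.a₁ = 0) (ha₂ : J.a₂ = uniformizer R * (w * β₂)) (h3 : J.a₃ = 0)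
    (ha₄ : J.a₄ = uniformizer R ^ 2 * (w ^ 2 * β₄))
    (ha₆ : J.a₆ = uniformizer R ^ 3 * (w ^ 3 * β₆))
    (hsemi : IsUnit (⟨0, β₂, 0, β₄, β₆⟩ : WeierstrassCurve R).Δ ∨
      IsUnit (⟨0, β₂, 0, β₄, β₆⟩ : WeierstrassCurve R).c₄) :
    ∃ n : ℕ, J.kodairaSymbolOfMinimal = .Istar n := by
  set ϖ := uniformizer R with hϖdef
  have hϖ : Irreducible ϖ := irreducible_uniformizer
  -- `J` is step-6 normalised
  have q1 : ϖ ∣ J.a₁ := by rw [h1]; exact dvd_zero _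
  have q2 : ϖ ∣ J.a₂ := ⟨w * β₂, ha₂⟩
  have q3 : ϖ ^ 2 ∣ J.a₃ := by rw [h3]; exact dvd_zero _
  have q4 : ϖ ^ 2 ∣ J.a₄ := ⟨w ^ 2 * β₄, ha₄⟩
  have q6 : ϖ ^ 3 ∣ J.a₆ := ⟨w ^ 3 * β₆, ha₆⟩
  -- the step-6 cubic of `J`
  have hP : cubicStep6 J = X ^ 3 + C (residue R (w * β₂)) * X ^ 2 + C (residue R (w ^ 2 * β₄)) * X +
      C (residue R (w ^ 3 * β₆)) := cubicStep6_eq ha₂ ha₄ ha₆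
  rw [show residue R (w * β₂) = residue R w * residue R β₂ from map_mul _ _ _,
    show residue R (w ^ 2 * β₄) = residue R w ^ 2 * residue R β₄ by rw [map_mul, map_pow],
    show residue R (w ^ 3 * β₆) = residue R w ^ 3 * residue R β₆ by rw [map_mul, map_pow]] at hP
  -- residues
  have hw0 : residue R w ≠ 0 := (isUnit_iff_residue_ne_zero w).mp hw
  have h20 : (2 : ResidueField R) ≠ 0 := residue_two_ne_zero h2
  have h16 : (16 : ResidueField R) ≠ 0 := by
    have : (16 : ResidueField R) = 2 ^ 4 := by norm_num
    rw [this]; exact pow_ne_zero _ h20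
  set w' := residue R w with hw'
  set b₂ := residue R β₂ with hb₂
  set b₄ := residue R β₄ with hb₄
  set b₆ := residue R β₆ with hb₆
  -- `Δ(V₀) = 16 · disc`, `c₄(V₀) = 16 · (β₂² − 3β₄)` in the residue field
  set D : ResidueField R := b₂ ^ 2 * b₄ ^ 2 - 4 * b₄ ^ 3 - 4 * b₂ ^ 3 * b₆ - 27 * b₆ ^ 2 +
    18 * b₂ * b₄ * b₆ with hD
  have hΔres : residue R (⟨0, β₂, 0, β₄, β₆⟩ : WeierstrassCurve R).Δ = 16 * D := by
    simp only [WeierstrassCurve.Δ, WeierstrassCurve.b₂, WeierstrassCurve.b₄, WeierstrassCurve.b₆,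
      WeierstrassCurve.b₈, map_add, map_sub, map_mul, map_pow, map_neg, map_ofNat, map_zero, hD]
    ring
  have hc₄res : residue R (⟨0, β₂, 0, β₄, β₆⟩ : WeierstrassCurve R).c₄ = 16 * (b₂ ^ 2 - 3 * b₄) := by
    simp only [WeierstrassCurve.c₄, WeierstrassCurve.b₂, WeierstrassCurve.b₄, map_add, map_sub,
      map_mul, map_pow, map_ofNat, map_zero]
    ring
  -- discriminant and `p² − 3q` of the cubic of `J` are unit multiples of those of `V₀`
  have hdiscJ : (w' * b₂) ^ 2 * (w' ^ 2 * b₄) ^ 2 - 4 * (w' ^ 2 * b₄) ^ 3 -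
      4 * (w' * b₂) ^ 3 * (w' ^ 3 * b₆) - 27 * (w' ^ 3 * b₆) ^ 2 +
      18 * (w' * b₂) * (w' ^ 2 * b₄) * (w' ^ 3 * b₆) = w' ^ 6 * D := by
    rw [hD]; ring
  have hpqJ : (w' * b₂) ^ 2 - 3 * (w' ^ 2 * b₄) = w' ^ 2 * (b₂ ^ 2 - 3 * b₄) := by ring
  by_cases hΔu : IsUnit (⟨0, β₂, 0, β₄, β₆⟩ : WeierstrassCurve R).Δ
  · -- good reduction of `V₀`: three distinct roots, type `I₀*`
    have hD0 : D ≠ 0 := by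
      have h := (isUnit_iff_residue_ne_zero _).mp hΔu
      rw [hΔres] at h
      exact right_ne_zero_of_mul h
    have h6 : distinctRootCount (cubicStep6 J) = 3 := by
      rw [hP]
      refine (distinctRootCount_cubic_eq_three_iff (w' * b₂) (w' ^ 2 * b₄) (w' ^ 3 * b₆)).mpr ?_
      rw [hdiscJ]
      exact mul_ne_zero (pow_ne_zero _ hw0) hD0
    exact ⟨0, kodairaSymbolOfMinimal_eq_Istar_zero_of_step6 q1 q2 q3 q4 q6 h6⟩
  · -- multiplicative reduction of `V₀`: a double root, type `Iₙ*`, `n ≥ 1`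
    have hc₄u : IsUnit (⟨0, β₂, 0, β₄, β₆⟩ : WeierstrassCurve R).c₄ := hsemi.resolve_left hΔu
    have hD0 : D = 0 := by
      have h := (isUnit_iff_residue_ne_zero
        (⟨0, β₂, 0, β₄, β₆⟩ : WeierstrassCurve R).Δ).not.mp hΔu
      rw [hΔres, not_not] at h
      exact (mul_eq_zero.mp h).resolve_left h16
    have hE0 : b₂ ^ 2 - 3 * b₄ ≠ 0 := by
      have h := (isUnit_iff_residue_ne_zero _).mp hc₄u
      rw [hc₄res] at h
      exact right_ne_zero_of_mul h
    have hdisc0 : (w' * b₂) ^ 2 * (w' ^ 2 * b₄) ^ 2 - 4 * (w' ^ 2 * b₄) ^ 3 -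
        4 * (w' * b₂) ^ 3 * (w' ^ 3 * b₆) - 27 * (w' ^ 3 * b₆) ^ 2 +
        18 * (w' * b₂) * (w' ^ 2 * b₄) * (w' ^ 3 * b₆) = 0 := by
      rw [hdiscJ, hD0, mul_zero]
    have h7 : distinctRootCount (cubicStep6 J) = 2 := by
      rw [hP]
      refine (distinctRootCount_cubic_eq_two_iff (w' * b₂) (w' ^ 2 * b₄) (w' ^ 3 * b₆) hdisc0).mpr ?_
      rw [hpqJ]
      exact mul_ne_zero (pow_ne_zero _ hw0) hE0
    -- the round-0 model of the `Iₙ*` sub-procedure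
    obtain ⟨C₇, hu, m1, m2, m3, m4, m6⟩ := exists_variableChange_step7_of_dvd q1 q2 q3 q4 q6 h7
    have s1 := mem_maximalIdeal_iff_dvd.mp m1
    have s2 := mem_maximalIdeal_iff_dvd.mp m2
    have s3 := mem_maximalIdeal_pow_iff_dvd.mp m3
    have s4 := mem_maximalIdeal_pow_iff_dvd.mp m4
    have s6 := mem_maximalIdeal_pow_iff_dvd.mp m6
    have d23 : ϖ ^ 2 ∣ ϖ ^ 3 := pow_dvd_pow ϖ (by norm_num)
    have d34 : ϖ ^ 3 ∣ ϖ ^ 4 := pow_dvd_pow ϖ (by norm_num)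
    have s2n : ¬ ϖ ^ 2 ∣ (C₇ • J).a₂ := by
      obtain ⟨hr, hs, ht⟩ := dvd_r_s_t_of_step6 hu q1 q2 q3 q4 q6 s1 s2 s3 (d23.trans s4)
        (d34.trans s6)
      refine not_sq_dvd_a₂_of_distinctRootCount_eq_two s4 s6 ?_
      rw [distinctRootCount_cubicStep6_smul hu q1 q2 q3 q4 q6 hr hs ht]; exact h7
    obtain ⟨hΔ, n3, n4, n6, hb₂', ha₆', hb₈', hb₆'⟩ := tests_of_step6 q1 q2 q3 q4 q6
    exact ⟨_, kodairaSymbolOfMinimal_eq_Istar_of_models hΔ (one_smul _ J).symm n3 n4 n6 hb₂' ha₆'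
      hb₈' hb₆' (one_smul _ J).symm q1 q2 q3 q4 q6 h7 rfl s1 s2 s2n s3 s4 s6⟩

end DVR

section Place

open IsDedekindDomain IsDedekindDomain.HeightOneSpectrum NumberField Rat.HeightOneSpectrum WeierstrassCurve
  Literature.NumberTheory.EllipticCurves

variable (v : HeightOneSpectrum (𝓞 ℚ))

/-- An element of `O_v` whose image in `ℚ_v` has valuation `1` is a unit. [folklore] -/
private theorem isUnit_of_valued_eq_one {x : v.adicCompletionIntegers ℚ}
    (h : Valued.v (x : v.adicCompletion ℚ) = 1) : IsUnit x := by
  obtain ⟨u, hu, hx⟩ := exists_isUnit_eq_uniformizer_pow_mul_of_valued_eq v (x := x) (n := 0)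
    (by rw [Nat.cast_zero, neg_zero, WithZero.exp_zero]; exact h)
  rw [hx, pow_zero, one_mul]; exact hu

/-- **The twist of a `v`-semistable curve by a parameter exactly divisible by the odd prime below
`v` has Kodaira type `Iₙ*` (`n ≥ 0`) at `v`.** For `V/ℚ` globally minimal with good or
multiplicative reduction at the place `v` over an odd prime `ℓ`, an integer `D` with `ℓ ∥ D`, and
ANY equation `W = C • V^{(D)}` of the quadratic twist: `W.kodairaSymbolAt v = Iₙ*` for some `n`
(`n = 0` iff `V` is good at `v`). The twisted equation `V^{(D)} : y² = x³ + D(b₂/4)x² +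
D²(b₄/2)x + D³(b₆/4)` is `v`-integral and `v`-minimal (`v(Δ) = 6 < 12`, resp. `v(c₄) = 2 < 4`,
Silverman *AEC* VII.1 Rem. 1.1); over `O_v` it is the twist by the uniformiser `D = ϖw` of the
semistable short equation `y² = x³ + (b₂/4)x² + (b₄/2)x + b₆/4` (same `Δ`, `c₄` as `V`), so
`kodairaSymbolOfMinimal_twist_semistable_eq_Istar` applies; the symbol is read on this minimal
model (`kodairaSymbolAt_eq_kodairaSymbolOfMinimal_of_isMinimal`) and is an isomorphism invariant
(`kodairaSymbolAt_smul'`). [cite: SilvermanATAEC1994, IV.9.4 Steps 6–7 (PDF pp. 345–346)]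
[cite: SilvermanAEC2009, VII.1 Remark 1.1 and Prop. 1.3] -/
theorem kodairaSymbolAt_twist_of_semistable (V : WeierstrassCurve ℚ) [V.IsElliptic]
    [V.IsGloballyMinimal] (hv2 : (primesEquiv v : ℕ) ≠ 2) {D : ℤ} (hD0 : D ≠ 0)
    (h1 : ((primesEquiv v : ℕ) : ℤ) ∣ D) (h2 : ¬ ((primesEquiv v : ℕ) : ℤ) ^ 2 ∣ D)
    (hV : V.HasGoodReductionAt v ∨ V.HasMultiplicativeReductionAt v)
    {W : WeierstrassCurve ℚ} [W.IsElliptic] (C : VariableChange ℚ)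
    (hW : C • V.quadraticTwist (D : ℚ) = W) :
    ∃ n : ℕ, W.kodairaSymbolAt v = .Istar n := by
  have hpP : (primesEquiv v : ℕ).Prime := (primesEquiv v).2
  have hpZ : Prime ((primesEquiv v : ℕ) : ℤ) := Nat.prime_iff_prime_int.mp hpP
  have hp2 : ¬ ((primesEquiv v : ℕ) : ℤ) ∣ 2 := fun h ↦
    hv2 ((Nat.prime_dvd_prime_iff_eq hpP Nat.prime_two).mp (Int.natCast_dvd_natCast.mp h))
  have hp4 : ¬ ((primesEquiv v : ℕ) : ℤ) ∣ 4 := fun h ↦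
    (hpZ.dvd_or_dvd (show ((primesEquiv v : ℕ) : ℤ) ∣ 2 * 2 by norm_num; exact h)).elim hp2 hp2
  have hDq : (D : ℚ) ≠ 0 := by exact_mod_cast hD0
  haveI := V.isElliptic_quadraticTwist hDq
  haveI : Finite (IsLocalRing.ResidueField (v.adicCompletionIntegers ℚ)) :=
    HeightOneSpectrum.finite_residueField_adicCompletionIntegers ℚ v
  haveI : PerfectField (IsLocalRing.ResidueField (v.adicCompletionIntegers ℚ)) :=
    PerfectField.ofFinite
  set X : WeierstrassCurve ℚ := V.quadraticTwist (D : ℚ) with hXdef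
  -- valuations of the ingredients
  set M : WeierstrassCurve ℤ := integralModelInt V with hM
  have hVM : M.map (Int.castRingHom ℚ) = V := map_integralModelInt V
  have hVb₂ : V.b₂ = (M.b₂ : ℚ) := by rw [← congrArg WeierstrassCurve.b₂ hVM, map_b₂, eq_intCast]
  have hVb₄ : V.b₄ = (M.b₄ : ℚ) := by rw [← congrArg WeierstrassCurve.b₄ hVM, map_b₄, eq_intCast]
  have hVb₆ : V.b₆ = (M.b₆ : ℚ) := by rw [← congrArg WeierstrassCurve.b₆ hVM, map_b₆, eq_intCast]
  have hv4 : v.valuation ℚ (4 : ℚ) = 1 := by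
    have h := valuation_ringOfIntegers_intCast_eq_one v (n := 4) (by exact_mod_cast hp4)
    simpa using h
  have hv2' : v.valuation ℚ (2 : ℚ) = 1 := by
    have h := valuation_ringOfIntegers_intCast_eq_one v (n := 2) (by exact_mod_cast hp2)
    simpa using h
  have hvD : v.valuation ℚ (D : ℚ) = WithZero.exp (-1 : ℤ) :=
    valuation_ringOfIntegers_intCast_eq_exp_neg_one v h1 h2
  have hvb₂ : v.valuation ℚ V.b₂ ≤ 1 := hVb₂ ▸ valuation_ringOfIntegers_intCast_le_one v _
  have hvb₄ : v.valuation ℚ V.b₄ ≤ 1 := hVb₄ ▸ valuation_ringOfIntegers_intCast_le_one v _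
  have hvb₆ : v.valuation ℚ V.b₆ ≤ 1 := hVb₆ ▸ valuation_ringOfIntegers_intCast_le_one v _
  have he1 : WithZero.exp (-1 : ℤ) ≤ 1 := by
    rw [← WithZero.exp_zero]; exact WithZero.exp_le_exp.mpr (by norm_num)
  have hvDle : v.valuation ℚ (D : ℚ) ≤ 1 := hvD ▸ he1
  have hβ₂v : v.valuation ℚ (V.b₂ / 4) ≤ 1 := by rw [map_div₀, hv4, div_one]; exact hvb₂
  have hβ₄v : v.valuation ℚ (V.b₄ / 2) ≤ 1 := by rw [map_div₀, hv2', div_one]; exact hvb₄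
  have hβ₆v : v.valuation ℚ (V.b₆ / 4) ≤ 1 := by rw [map_div₀, hv4, div_one]; exact hvb₆
  -- the twisted equation is `v`-integral
  have hint : X.IsIntegralAt v := by
    refine X.isIntegralAt_of_valuation_le_one v ?_ ?_ ?_ ?_ ?_
    · simp [hXdef]
    · rw [hXdef, quadraticTwist_a₂, mul_div_assoc, map_mul]
      exact mul_le_one' hvDle hβ₂v
    · simp [hXdef]
    · rw [hXdef, quadraticTwist_a₄, mul_div_assoc, map_mul, map_pow]
      exact mul_le_one' (pow_le_one' hvDle 2) hβ₄v
    · rw [hXdef, quadraticTwist_a₆, mul_div_assoc, map_mul, map_pow]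
      exact mul_le_one' (pow_le_one' hvDle 3) hβ₆v
  -- the reduction of `V` at `v`, read on the minimal equation `V`
  have hVmin : V.IsMinimalAt v := IsGloballyMinimal.isMinimalAt V v
  have hsemiV : v.valuation ℚ V.Δ = 1 ∨ v.valuation ℚ V.c₄ = 1 := by
    rcases hV with hgood | hmult
    · exact Or.inl ((hasGoodReductionAt_iff_of_isMinimalAt (v := v) (W := V) hVmin).mp hgood)
    · exact Or.inr ((hasMultiplicativeReductionAt_iff_of_isMinimalAt (v := v) (W := V) hVmin).mp
        hmult).2
  -- the twisted equation is minimal at `v`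
  have hmin : X.IsMinimalAt v := by
    rcases hsemiV with hΔ | hc₄
    · refine isMinimalAt_of_lt_valuation_Δ_holds hint ?_
      rw [hXdef, quadraticTwist_Δ, map_mul, map_pow, hvD, hΔ, mul_one, ← WithZero.exp_nsmul]
      exact WithZero.exp_lt_exp.mpr (by norm_num)
    · refine isMinimalAt_of_lt_valuation_c₄ hint ?_
      rw [hXdef, quadraticTwist_c₄, map_mul, map_pow, hvD, hc₄, mul_one, ← WithZero.exp_nsmul]
      exact WithZero.exp_lt_exp.mpr (by norm_num)
  -- the `O_v`-model `J` of `X` and the short model `V₀` of `V`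
  have memO : ∀ x : ℚ, v.valuation ℚ x ≤ 1 →
      algebraMap ℚ (v.adicCompletion ℚ) x ∈ v.adicCompletionIntegers ℚ := fun x hx ↦ by
    rwa [HeightOneSpectrum.mem_adicCompletionIntegers, valued_algebraMap_adicCompletion]
  set δ : v.adicCompletionIntegers ℚ := ⟨algebraMap ℚ (v.adicCompletion ℚ) (D : ℚ), memO _ hvDle⟩
    with hδdef
  set β₂ : v.adicCompletionIntegers ℚ := ⟨algebraMap ℚ (v.adicCompletion ℚ) (V.b₂ / 4), memO _ hβ₂v⟩
    with hβ₂def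
  set β₄ : v.adicCompletionIntegers ℚ := ⟨algebraMap ℚ (v.adicCompletion ℚ) (V.b₄ / 2), memO _ hβ₄v⟩
    with hβ₄def
  set β₆ : v.adicCompletionIntegers ℚ := ⟨algebraMap ℚ (v.adicCompletion ℚ) (V.b₆ / 4), memO _ hβ₆v⟩
    with hβ₆def
  set J : WeierstrassCurve (v.adicCompletionIntegers ℚ) := ⟨0, δ * β₂, 0, δ ^ 2 * β₄, δ ^ 3 * β₆⟩
    with hJdef
  set V₀ : WeierstrassCurve (v.adicCompletionIntegers ℚ) := ⟨0, β₂, 0, β₄, β₆⟩ with hV₀def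
  have hJX : J.baseChange (v.adicCompletion ℚ) = X.baseChange (v.adicCompletion ℚ) := by
    ext
    · simp [hJdef, hXdef, baseChange]
    · simp only [hJdef, hXdef, baseChange, map_a₂, quadraticTwist_a₂, mul_div_assoc, map_mul]
      rfl
    · simp [hJdef, hXdef, baseChange]
    · simp only [hJdef, hXdef, baseChange, map_a₄, quadraticTwist_a₄, mul_div_assoc, map_mul, map_pow]
      rfl
    · simp only [hJdef, hXdef, baseChange, map_a₆, quadraticTwist_a₆, mul_div_assoc, map_mul, map_pow]
      rfl
  -- `D = ϖ w` and `2 ∈ O_vˣ`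
  obtain ⟨w, hw, hδ⟩ := exists_isUnit_eq_uniformizer_pow_mul_of_valued_eq v (x := δ) (n := 1)
    (by rw [hδdef]; push_cast; rw [valued_algebraMap_adicCompletion, hvD])
  rw [pow_one] at hδ
  have h2O : IsUnit (2 : v.adicCompletionIntegers ℚ) := by
    refine isUnit_of_valued_eq_one v ?_
    have : ((2 : v.adicCompletionIntegers ℚ) : v.adicCompletion ℚ) =
        algebraMap ℚ (v.adicCompletion ℚ) 2 := by
      rw [← ValuationSubring.algebraMap_apply, map_ofNat, map_ofNat]
    rw [this, valued_algebraMap_adicCompletion, hv2']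
  -- semistability of `V₀`: `Δ(V₀) = Δ(V)`, `c₄(V₀) = c₄(V)` (the short model `V₀ℚ` of `V`)
  set V₀ℚ : WeierstrassCurve ℚ := ⟨0, V.b₂ / 4, 0, V.b₄ / 2, V.b₆ / 4⟩ with hV₀ℚdef
  have hV₀map : V₀.map (algebraMap (v.adicCompletionIntegers ℚ) (v.adicCompletion ℚ)) =
      V₀ℚ.baseChange (v.adicCompletion ℚ) := by
    ext <;> rfl
  have hΔℚ : V₀ℚ.Δ = V.Δ := by
    simp only [hV₀ℚdef, WeierstrassCurve.Δ, WeierstrassCurve.b₂, WeierstrassCurve.b₄,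
      WeierstrassCurve.b₆, WeierstrassCurve.b₈]
    ring
  have hc₄ℚ : V₀ℚ.c₄ = V.c₄ := by
    simp only [hV₀ℚdef, WeierstrassCurve.c₄, WeierstrassCurve.b₂, WeierstrassCurve.b₄]
    ring
  have hV₀Δ : ((V₀.Δ : v.adicCompletionIntegers ℚ) : v.adicCompletion ℚ) =
      algebraMap ℚ (v.adicCompletion ℚ) V.Δ := by
    rw [← hΔℚ, ← ValuationSubring.algebraMap_apply, ← map_Δ, hV₀map, baseChange, map_Δ]
  have hV₀c₄ : ((V₀.c₄ : v.adicCompletionIntegers ℚ) : v.adicCompletion ℚ) =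
      algebraMap ℚ (v.adicCompletion ℚ) V.c₄ := by
    rw [← hc₄ℚ, ← ValuationSubring.algebraMap_apply, ← map_c₄, hV₀map, baseChange, map_c₄]
  have hsemi : IsUnit V₀.Δ ∨ IsUnit V₀.c₄ := by
    rcases hsemiV with hΔ | hc₄
    · left
      refine isUnit_of_valued_eq_one v ?_
      rw [hV₀Δ, valued_algebraMap_adicCompletion, hΔ]
    · right
      refine isUnit_of_valued_eq_one v ?_
      rw [hV₀c₄, valued_algebraMap_adicCompletion, hc₄]
  -- Tate's algorithm on `J`
  obtain ⟨n, hn⟩ := kodairaSymbolOfMinimal_twist_semistable_eq_Istar (J := J) h2O hw rfl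
    (by rw [hJdef, hδ]; ring) rfl (by rw [hJdef, hδ]; ring) (by rw [hJdef, hδ]; ring) hsemi
  -- read at the place `v`
  haveI hJmin : (J.baseChange (v.adicCompletion ℚ)).IsMinimal (v.adicCompletionIntegers ℚ) := by
    rw [hJX]; exact hmin
  have hΔJ : (J.baseChange (v.adicCompletion ℚ)).Δ ≠ 0 := by
    rw [hJX, baseChange, map_Δ]
    exact (_root_.map_ne_zero _).mpr X.isUnit_Δ.ne_zero
  have hkX : X.kodairaSymbolAt v = J.kodairaSymbolOfMinimal := by
    rw [kodairaSymbolAt_eq_kodairaSymbolOfMinimal_of_isMinimal v X (J.baseChange (v.adicCompletion ℚ))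
      1 (by rw [one_smul, hJX]) hΔJ, integralModel_baseChange_eq]
  refine ⟨n, ?_⟩
  rw [← hW, kodairaSymbolAt_smul', hkX, hn]

end Place

end Summit.BirchSwinnertonDyer.Rank1Residual.Additive

end
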